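import Summits.AtomisticToContinuum.FouriersLaw.Theses.EmbeddedDrudeMourre
import Summits.AtomisticToContinuum.FouriersLaw.Theorems.FGRGap.Negative.LoadBearing

/-!
# FGRGap, line `fold-jet-rigidity`, stub S4b (gap closing) — part A: the `L²(cell)` glue

Support file for crux `EmbeddedDrudeMourre.FGRGap` (item stmt-AtomisticToContinuum-12595), stub
`stub_gapClosing` (the variational closing `lsc ∧ convex ∧ odd essential gap ∧ no odd null vector ⇒
odd-sector gap`). This part contains no statement about the Boltzmann form: it is the dictionary
between the tree's function-level vocabulary on the Brillouin cell `(-π, π]`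
(`cellNormSq f = ∫⁻ f²`, `cellPairing φ f = ∫ φ f`, `2π`-periodic measurable odd `f : ℝ → ℝ`) and
the real Hilbert space `Lp ℝ 2 (volume.restrict (Ioc (-π) π))` in which the weak-compactness /
Mazur argument of the closing runs:

* `eLpNorm_cell_sq`, `memLp_two_cell`, `ofReal_norm_sq_eq_cellNormSq`, `norm_toLp_eq_one`:
  `‖·‖²_{L²(cell)} = cellNormSq`;
* `inner_toLp_eq_cellPairing`: `⟪toLp φ, U⟫ = cellPairing φ g` for any representative `g` of `U`;
  `lincomb_ae_eq`: representatives of `a • U₁ + b • U₂`;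
* `exists_periodic_rep`: every class `U` has a `2π`-periodic measurable representative
  (periodisation through `toIocMod`);
* `ae_cell_neg`, `exists_odd_rep`: reflection `k ↦ -k` preserves null sets of the cell, so an
  a.e. limit of odd functions has an odd periodic measurable representative;
* `exists_subseq_ae_tendsto`: a strongly convergent sequence in `L²(cell)` has an a.e. convergent
  subsequence (convergence in measure).
-/

noncomputable section

open MeasureTheory Set Real Filter Topology
open scoped ENNReal
open Literature.MathematicalPhysics.KineticTheory.PhononBoltzmann
open Summit.AtomisticToContinuum.FouriersLaw.Theorems.FGRGap

namespace Summit.AtomisticToContinuum.FouriersLaw.Theorems.FGRGap.FoldJetRigidity.Closing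

/-! ## Norms -/

/-- `‖g‖_{L²(cell)}² = cellNormSq g` (the `p = 2` `eLpNorm` squared is the lower integral of `g²`).
[folklore] -/
theorem eLpNorm_cell_sq (g : ℝ → ℝ) :
    eLpNorm g 2 (volume.restrict (Ioc (-π) π)) ^ 2 = cellNormSq g := by
  rw [eLpNorm_eq_lintegral_rpow_enorm_toReal two_ne_zero ENNReal.ofNat_ne_top]
  simp only [ENNReal.toReal_ofNat, one_div]
  rw [← ENNReal.rpow_natCast, ← ENNReal.rpow_mul]
  norm_num
  unfold cellNormSq
  refine lintegral_congr fun k => ?_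
  rw [← Real.enorm_eq_ofReal (sq_nonneg _), enorm_pow]

/-- A measurable function with `cellNormSq g < ∞` is in `L²(cell)`. [folklore] -/
theorem memLp_two_cell {g : ℝ → ℝ} (hg : Measurable g) (hfin : cellNormSq g < ∞) :
    MemLp g 2 (volume.restrict (Ioc (-π) π)) := by
  refine ⟨hg.aestronglyMeasurable, ?_⟩
  rw [lt_top_iff_ne_top]
  intro htop
  have h := eLpNorm_cell_sq g
  rw [htop, ENNReal.top_pow two_ne_zero] at h
  exact hfin.ne h.symm

/-- For any representative `g` of a class `U ∈ L²(cell)`: `ofReal ‖U‖² = cellNormSq g`.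
[folklore] -/
theorem ofReal_norm_sq_eq_cellNormSq (U : Lp ℝ 2 (volume.restrict (Ioc (-π) π))) {g : ℝ → ℝ}
    (h : g =ᵐ[volume.restrict (Ioc (-π) π)] U) : ENNReal.ofReal (‖U‖ ^ 2) = cellNormSq g := by
  rw [← eLpNorm_cell_sq, eLpNorm_congr_ae h, Lp.norm_def, ENNReal.ofReal_pow ENNReal.toReal_nonneg,
    ENNReal.ofReal_toReal (Lp.eLpNorm_ne_top U)]

/-- `ofReal ‖toLp g‖² = cellNormSq g`. [folklore] -/
theorem ofReal_norm_toLp_sq {g : ℝ → ℝ} (hg : MemLp g 2 (volume.restrict (Ioc (-π) π))) :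
    ENNReal.ofReal (‖hg.toLp g‖ ^ 2) = cellNormSq g :=
  ofReal_norm_sq_eq_cellNormSq _ hg.coeFn_toLp.symm

/-- A representative of a class in `L²(cell)` has finite `cellNormSq`. [folklore] -/
theorem cellNormSq_lt_top_of_ae_eq (U : Lp ℝ 2 (volume.restrict (Ioc (-π) π))) {g : ℝ → ℝ}
    (h : g =ᵐ[volume.restrict (Ioc (-π) π)] U) : cellNormSq g < ∞ := by
  rw [← ofReal_norm_sq_eq_cellNormSq U h]
  exact ENNReal.ofReal_lt_top

/-- A representative of a NON-ZERO class in `L²(cell)` has non-zero `cellNormSq`. [folklore] -/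
theorem cellNormSq_ne_zero_of_ae_eq {U : Lp ℝ 2 (volume.restrict (Ioc (-π) π))} (hU : U ≠ 0)
    {g : ℝ → ℝ} (h : g =ᵐ[volume.restrict (Ioc (-π) π)] U) : cellNormSq g ≠ 0 := by
  rw [← ofReal_norm_sq_eq_cellNormSq U h]
  have : 0 < ‖U‖ := norm_pos_iff.2 hU
  have : 0 < ‖U‖ ^ 2 := by positivity
  exact fun h0 => absurd (ENNReal.ofReal_eq_zero.1 h0) (not_le.2 this)

/-- Unit vectors: `cellNormSq g = 1 ⇒ ‖toLp g‖ = 1`. [folklore] -/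
theorem norm_toLp_eq_one {g : ℝ → ℝ} (hg : MemLp g 2 (volume.restrict (Ioc (-π) π)))
    (h1 : cellNormSq g = 1) : ‖hg.toLp g‖ = 1 := by
  have h := ofReal_norm_toLp_sq hg
  rw [h1] at h
  have h2 : ‖hg.toLp g‖ ^ 2 = 1 := by
    have h' := congrArg ENNReal.toReal h
    rwa [ENNReal.toReal_ofReal (sq_nonneg _), ENNReal.toReal_one] at h'
  have h3 : 0 ≤ ‖hg.toLp g‖ := norm_nonneg _
  nlinarith

/-! ## Pairings and linear combinations -/

/-- The `L²(cell)` inner product of `toLp φ` with a class `U` is the cell pairing of `φ` with any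
representative of `U`. [folklore] -/
theorem inner_toLp_eq_cellPairing {φ : ℝ → ℝ} (hφ : MemLp φ 2 (volume.restrict (Ioc (-π) π)))
    (U : Lp ℝ 2 (volume.restrict (Ioc (-π) π))) {g : ℝ → ℝ}
    (h : g =ᵐ[volume.restrict (Ioc (-π) π)] U) : @inner ℝ _ _ (hφ.toLp φ) U = cellPairing φ g := by
  rw [MeasureTheory.L2.inner_def]
  unfold cellPairing
  refine integral_congr_ae ?_
  filter_upwards [hφ.coeFn_toLp, h] with k hk1 hk2
  rw [hk1, ← hk2]
  simp only [RCLike.inner_apply, conj_trivial]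
  ring

/-- Linear combinations of representatives represent the linear combination of the classes.
[folklore] -/
theorem lincomb_ae_eq {U₁ U₂ : Lp ℝ 2 (volume.restrict (Ioc (-π) π))} {g₁ g₂ : ℝ → ℝ}
    (h₁ : g₁ =ᵐ[volume.restrict (Ioc (-π) π)] U₁) (h₂ : g₂ =ᵐ[volume.restrict (Ioc (-π) π)] U₂)
    (a b : ℝ) :
    (fun k => a * g₁ k + b * g₂ k) =ᵐ[volume.restrict (Ioc (-π) π)] ⇑(a • U₁ + b • U₂) := by
  filter_upwards [h₁, h₂, Lp.coeFn_add (a • U₁) (b • U₂), Lp.coeFn_smul a U₁, Lp.coeFn_smul b U₂]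
    with k hk1 hk2 hadd hs1 hs2
  rw [hadd, Pi.add_apply, hs1, hs2, Pi.smul_apply, Pi.smul_apply, smul_eq_mul, smul_eq_mul, hk1,
    hk2]

/-! ## Representatives: periodisation, reflection, oddisation -/

/-- `toIocMod` onto the cell is measurable (it is an affine function of a fractional part).
[folklore] -/
theorem measurable_toIocMod_cell : Measurable (toIocMod Real.two_pi_pos (-π)) := by
  have : toIocMod Real.two_pi_pos (-π) =
      fun b => -π + 2 * π - Int.fract ((-π + 2 * π - b) / (2 * π)) * (2 * π) :=
    funext fun b => toIocMod_eq_sub_fract_mul _ _ _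
  rw [this]
  fun_prop

/-- Periodisation from the cell: every measurable `r` agrees on `(-π, π]` with a `2π`-periodic
measurable function. [folklore] -/
theorem exists_periodic_eqOn_cell {r : ℝ → ℝ} (hr : Measurable r) :
    ∃ p : ℝ → ℝ, Function.Periodic p (2 * π) ∧ Measurable p ∧ ∀ k ∈ Ioc (-π) π, p k = r k := by
  refine ⟨fun x => r (toIocMod Real.two_pi_pos (-π) x), fun x => ?_,
    hr.comp measurable_toIocMod_cell, fun k hk => ?_⟩
  · simp only [toIocMod_add_right]
  · simp only
    rw [(toIocMod_eq_self _).2]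
    rwa [show -π + 2 * π = π by ring]

/-- Every class of `L²(cell)` has a `2π`-periodic measurable representative. [folklore] -/
theorem exists_periodic_rep (U : Lp ℝ 2 (volume.restrict (Ioc (-π) π))) :
    ∃ r : ℝ → ℝ, Function.Periodic r (2 * π) ∧ Measurable r ∧
      r =ᵐ[volume.restrict (Ioc (-π) π)] U := by
  obtain ⟨p, hper, hmeas, hp⟩ := exists_periodic_eqOn_cell (Lp.stronglyMeasurable U).measurable
  exact ⟨p, hper, hmeas, (ae_restrict_mem measurableSet_Ioc).mono fun k hk => hp k hk⟩

/-- Reflection `k ↦ -k` preserves null sets of the cell: a property holding a.e. on `(-π, π]`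
holds a.e. at `-k` (away from the boundary point `π`, whose reflection leaves the cell).
[folklore] -/
theorem ae_cell_neg {P : ℝ → Prop} (h : ∀ᵐ k ∂(volume.restrict (Ioc (-π) π)), P k) :
    ∀ᵐ k ∂(volume.restrict (Ioc (-π) π)), k ≠ π → P (-k) := by
  rw [ae_restrict_iff' measurableSet_Ioc] at h ⊢
  rw [ae_iff] at h ⊢
  refine measure_mono_null (t := -{k | ¬(k ∈ Ioc (-π) π → P k)}) ?_ ?_
  · intro k hk
    simp only [mem_setOf_eq, Classical.not_imp] at hk
    obtain ⟨hk, hkπ, hP⟩ := hk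
    simp only [Set.mem_neg, mem_setOf_eq, Classical.not_imp]
    refine ⟨⟨?_, ?_⟩, hP⟩
    · linarith [hk.2, lt_of_le_of_ne hk.2 hkπ]
    · linarith [hk.1]
  · rw [Measure.measure_neg]
    exact h

/-- Almost every point of the cell is not the endpoint `π`. [folklore] -/
theorem ae_cell_ne_pi : ∀ᵐ k ∂(volume.restrict (Ioc (-π) π)), k ≠ π := by
  refine ae_restrict_of_ae ?_
  rw [ae_iff]
  simp only [ne_eq, not_not, setOf_eq_eq_singleton, measure_singleton]

/-- Oddisation: a `2π`-periodic measurable function which is an a.e. limit on the cell of ODD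
functions agrees a.e. on the cell with an odd `2π`-periodic measurable function (its odd part).
[folklore] -/
theorem exists_odd_rep {r : ℝ → ℝ} (hper : Function.Periodic r (2 * π)) (hmeas : Measurable r)
    {g : ℕ → ℝ → ℝ} (hodd : ∀ n, Function.Odd (g n))
    (hconv : ∀ᵐ k ∂(volume.restrict (Ioc (-π) π)), Tendsto (fun n => g n k) atTop (𝓝 (r k))) :
    ∃ r' : ℝ → ℝ, Function.Periodic r' (2 * π) ∧ Measurable r' ∧ Function.Odd r' ∧
      r' =ᵐ[volume.restrict (Ioc (-π) π)] r := by
  refine ⟨fun k => (1 / 2) * (r k - r (-k)), fun k => ?_, ?_, fun k => ?_, ?_⟩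
  · simp only
    rw [hper k, neg_add, ← sub_eq_add_neg, hper.sub_eq]
  · exact (hmeas.sub (hmeas.comp measurable_neg)).const_mul _
  · simp only [neg_neg]
    ring
  · filter_upwards [hconv, ae_cell_neg hconv, ae_cell_ne_pi] with k hk hk2 hkπ
    have h3 : Tendsto (fun n => g n (-k)) atTop (𝓝 (r (-k))) := hk2 hkπ
    have h4 : Tendsto (fun n => g n (-k)) atTop (𝓝 (-r k)) := by
      simp_rw [hodd _ _]
      exact hk.neg
    rw [tendsto_nhds_unique h3 h4]
    ring

/-! ## Strong convergence gives an a.e. convergent subsequence -/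

/-- A sequence converging in `L²(cell)` has a subsequence converging a.e. on the cell, stated for
arbitrary representatives. [folklore] -/
theorem exists_subseq_ae_tendsto {G : ℕ → Lp ℝ 2 (volume.restrict (Ioc (-π) π))}
    {U : Lp ℝ 2 (volume.restrict (Ioc (-π) π))} (hG : Tendsto G atTop (𝓝 U)) {g : ℕ → ℝ → ℝ}
    (hg : ∀ n, g n =ᵐ[volume.restrict (Ioc (-π) π)] G n) {r : ℝ → ℝ}
    (hr : r =ᵐ[volume.restrict (Ioc (-π) π)] U) :
    ∃ ns : ℕ → ℕ, StrictMono ns ∧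
      ∀ᵐ k ∂(volume.restrict (Ioc (-π) π)), Tendsto (fun i => g (ns i) k) atTop (𝓝 (r k)) := by
  have h1 : Tendsto (fun n => eLpNorm (⇑(G n) - ⇑U) 2 (volume.restrict (Ioc (-π) π))) atTop
      (𝓝 0) :=
    (Lp.tendsto_Lp_iff_tendsto_eLpNorm' _ _).1 hG
  have h2 : TendstoInMeasure (volume.restrict (Ioc (-π) π)) (fun n => (G n : ℝ → ℝ)) atTop
      (U : ℝ → ℝ) :=
    tendstoInMeasure_of_tendsto_eLpNorm two_ne_zero (fun n => Lp.aestronglyMeasurable _)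
      (Lp.aestronglyMeasurable _) h1
  obtain ⟨ns, hns, hae⟩ := h2.exists_seq_tendsto_ae
  refine ⟨ns, hns, ?_⟩
  have hall : ∀ᵐ k ∂(volume.restrict (Ioc (-π) π)), ∀ n, g n k = G n k := ae_all_iff.2 hg
  filter_upwards [hae, hall, hr] with k hk hk2 hk3
  rw [hk3]
  simp_rw [hk2]
  exact hk

end Summit.AtomisticToContinuum.FouriersLaw.Theorems.FGRGap.FoldJetRigidity.Closing

namespace Summit.AtomisticToContinuum.FouriersLaw.Theorems.FGRGap.FoldJetRigidity

/-- Helper stub A of `stub_gapClosing` (line fold-jet-rigidity): a strongly convergent sequence in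
`L²(cell)` has an a.e. convergent subsequence, for arbitrary representatives. [folklore] -/
theorem stub_gapClosing_partA :
    ∀ (G : ℕ → MeasureTheory.Lp ℝ 2 (MeasureTheory.volume.restrict (Set.Ioc (-π) π))) (U : MeasureTheory.Lp ℝ 2 (MeasureTheory.volume.restrict (Set.Ioc (-π) π))) (g : ℕ → ℝ → ℝ) (r : ℝ → ℝ), Filter.Tendsto G Filter.atTop (nhds U) → (∀ n, g n =ᵐ[MeasureTheory.volume.restrict (Set.Ioc (-π) π)] G n) → r =ᵐ[MeasureTheory.volume.restrict (Set.Ioc (-π) π)] U → ∃ ns : ℕ → ℕ, StrictMono ns ∧ ∀ᵐ k ∂(MeasureTheory.volume.restrict (Set.Ioc (-π) π)), Filter.Tendsto (fun i => g (ns i) k) Filter.atTop (nhds (r k)) :=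
  fun _ _ _ _ hG hg hr => Closing.exists_subseq_ae_tendsto hG hg hr

end Summit.AtomisticToContinuum.FouriersLaw.Theorems.FGRGap.FoldJetRigidity

end
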